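import Literature.AlgebraicGeometry.Frobenioids.CdTransport
import HarnessLib

/-!
# Frobenioids I, Definition 1.1 (iii): "`Φ ↦ F_Φ` is functorial" — the functor `F_Φ → F_{Φ'}` induced by a
# homomorphism of monoids `κ : Φ → Φ'` on `D`, and the natural isomorphism `Φ ≅ d · Φ`

Mochizuki, *The geometry of Frobenioids I: the general theory*, Kyushu J. Math. **62** (2008) 293–400,
Definition 1.1 (iii), kurims text p. 20 [cite: MochizukiFrdI2008, Def. 1.1(iii) p.20]:
"the assignment `Φ ↦ F_Φ` is functorial with respect to homomorphisms of functors [on `D`] valued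
in monoids `Φ → Φ'`"; Definition 2.4 (iii), kurims text p. 48 ll. 27–38 [cite: MochizukiFrdI2008,
Def. 2.4(iii) p.48]: "Let `Λ` be a monoid type that supports `Φ` [cf. Definition 1.1, (ii)]; `d ∈ Λ_{>0}`. Then
we shall write `d · Φ(−) ⊆ Φ(−)` for the subfunctor of `Φ` determined by the assignment
`Ob((C^istr)^lin) ∋ A ↦ d · (Φ(A)) (⊆ Φ(A))` and `C(d) ⊆ C` for the subcategory determined by the arrows whose
zero divisor lies in `d · Φ(−) ⊆ Φ(−)`. Finally, multiplication by `d` on `Φ(−)` determines a “Frobenius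
functor” [associated to `d` — cf. Proposition 2.1, (ii)] `F_Φ → F_Φ` which is compatible with Frobenius degrees
and the natural projection functor `F_Φ → D`."  (End of quotation.  Print does not write an isomorphism
`Φ ⥲ d · Φ`; that symbol and the natural isomorphism `imageMonoidIso : Φ ≅ imageMonoid δ` below are OUR
formulation, for an endomorphism `δ` that is injective on every `Φ(A)` — taken directly as the binder `hδ`,
nothing rides on reading "supports" as injectivity — of the identification print USES at Prop. 2.5 (iii) (b),
p. 49 l. 9: "`C(d) → F_{d·Φ} = (F_Φ)(d) ⊆ F_Φ`".)

Contents (definitions, abc-iut cell tooling for GAP-LEDGER row G-L6t9-1 part (T3); seat abc-iut-w4-d018):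
* `hom_app_pull` — a homomorphism `κ : Φ → Φ'` commutes with the pull-back maps (naturality).
* `ElemFrobenioid.map κ : F_Φ ⥤ F_{Φ'}` — the IDENTITY on objects (both are the objects of `D`),
  `(φ_D, Z_φ, n_φ) ↦ (φ_D, κ(Z_φ), n_φ)`; it generalises the landed `ElemFrobenioid.mapEnd δ` (the case
  `Φ' = Φ`: `mapEnd_eq_map`, `rfl`), commutes strictly with the projections to `D` (`map_comp_baseFunctor`,
  `rfl`) and is strictly functorial in `κ` (`map_id_eq`, `map_comp_eq`, both `rfl`).
* `ElemFrobenioid.mapEquivOfIso θ : F_Φ ≌ F_{Φ'}` for an isomorphism `θ : Φ ≅ Φ'` of monoids on `D`.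
* `imageMonoidIso δ hδ : Φ ≅ imageMonoid δ` — for `δ : Φ → Φ` injective on every `Φ(A)`, the natural
  isomorphism `δ : Φ ⥲ d · Φ` assembled from the objectwise `imageEquiv` of `CdTransport.lean`
  (abc-iut-L6-t9 lineage, [FrdI] Prop. 2.5 (iii) bracket).

No instance, no notation, no Prop-valued definition; nothing of [FrdI] is asserted here.
-/

noncomputable section

namespace Literature.AlgebraicGeometry.Frobenioids

open CategoryTheory Opposite

universe w v u

variable {D : Type u} [Category.{v} D] {Φ Φ' Φ'' : Dᵒᵖ ⥤ CommMonCat.{w}}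

/-! ### Homomorphisms of monoids on `D` commute with pull-backs -/

/-- A homomorphism `κ : Φ → Φ'` of functors valued in monoids commutes with the pull-back maps:
`κ_B(f^* x) = f^*(κ_A x)` (naturality of `κ`; the case `Φ' = Φ` is the landed `end_app_pull`).
[cite: MochizukiFrdI2008, Def. 1.1(iii) p.20] -/
theorem hom_app_pull (κ : Φ ⟶ Φ') {A B : D} (f : B ⟶ A) (x : Φ.obj (op A)) :
    (κ.app (op B)).hom (pull Φ f x) = pull Φ' f ((κ.app (op A)).hom x) := by
  have h := congrArg (fun g => (CommMonCat.Hom.hom g) x) (κ.naturality f.op)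
  simp only [CommMonCat.hom_comp, MonoidHom.coe_comp, Function.comp_apply] at h
  exact h

namespace ElemFrobenioid

/-! ### Definition 1.1 (iii): the functor `F_Φ → F_{Φ'}` induced by `κ : Φ → Φ'` -/

/-- **"`Φ ↦ F_Φ` is functorial with respect to homomorphisms of functors valued in monoids `Φ → Φ'`"**
(FrdI Def. 1.1 (iii), p. 20): the functor `F_Φ → F_{Φ'}` induced by `κ : Φ → Φ'` is the identity on objects
(the objects of both categories are those of `D`) and sends `(φ_D, Z_φ, n_φ) ↦ (φ_D, κ(Z_φ), n_φ)`.
[cite: MochizukiFrdI2008, Def. 1.1(iii) p.20] -/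
def map (κ : Φ ⟶ Φ') : ElemFrobenioid Φ ⥤ ElemFrobenioid Φ' where
  obj A := A
  map {A B} φ := ⟨φ.base, (κ.app (op A.base)).hom φ.div, φ.degFr⟩
  map_id A := Hom.ext rfl (map_one _) rfl
  map_comp {A B C} φ ψ := Hom.ext rfl
    (by
      show (κ.app (op A.base)).hom (pull Φ φ.base ψ.div * φ.div ^ (ψ.degFr : ℕ)) =
        pull Φ' φ.base ((κ.app (op B.base)).hom ψ.div) * ((κ.app (op A.base)).hom φ.div) ^ (ψ.degFr : ℕ)
      rw [map_mul, map_pow, hom_app_pull])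
    rfl

/-- `map κ` is the identity on objects. [cite: MochizukiFrdI2008, Def. 1.1(iii) p.20] -/
@[simp] theorem map_obj (κ : Φ ⟶ Φ') (A : ElemFrobenioid Φ) : (map κ).obj A = A := rfl

/-- The base object is unchanged by `map κ`. [cite: MochizukiFrdI2008, Def. 1.1(iii) p.20] -/
@[simp] theorem base_map_obj (κ : Φ ⟶ Φ') (A : ElemFrobenioid Φ) : ((map κ).obj A).base = A.base := rfl

/-- `map κ` preserves `Base`. [cite: MochizukiFrdI2008, Def. 1.1(iii) p.20] -/
@[simp] theorem base_map_map (κ : Φ ⟶ Φ') {A B : ElemFrobenioid Φ} (φ : A ⟶ B) :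
    Base ((map κ).map φ) = Base φ := rfl

/-- `map κ` applies `κ` to `Div`. [cite: MochizukiFrdI2008, Def. 1.1(iii) p.20] -/
@[simp] theorem div_map_map (κ : Φ ⟶ Φ') {A B : ElemFrobenioid Φ} (φ : A ⟶ B) :
    Div ((map κ).map φ) = (κ.app (op A.base)).hom (Div φ) := rfl

/-- `map κ` preserves `deg_Fr`. [cite: MochizukiFrdI2008, Def. 1.1(iii) p.20] -/
@[simp] theorem degFr_map_map (κ : Φ ⟶ Φ') {A B : ElemFrobenioid Φ} (φ : A ⟶ B) :
    degFr ((map κ).map φ) = degFr φ := rfl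

/-- `map κ` on a morphism built by `homMk`. [cite: MochizukiFrdI2008, Def. 1.1(iii) p.20] -/
@[simp] theorem map_map_homMk (κ : Φ ⟶ Φ') {A B : ElemFrobenioid Φ} (f : A.base ⟶ B.base)
    (Z : Φ.obj (op A.base)) (n : ℕ+) :
    (map κ).map (homMk f Z n) = homMk (A := (map κ).obj A) (B := (map κ).obj B) f ((κ.app (op A.base)).hom Z) n :=
  rfl

/-- `map κ` commutes strictly with the projections to the base category `D`.
[cite: MochizukiFrdI2008, Def. 1.1(iii) p.20] -/
theorem map_comp_baseFunctor (κ : Φ ⟶ Φ') : map κ ⋙ baseFunctor Φ' = baseFunctor Φ := rfl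

/-- The landed endomorphism case: `mapEnd δ = map δ` (definitionally).
[cite: MochizukiFrdI2008, Def. 1.1(iii) p.20] -/
theorem mapEnd_eq_map (δ : Φ ⟶ Φ) : mapEnd δ = map δ := rfl

/-- Strict functoriality in `κ`: the identity homomorphism induces the identity functor.
[cite: MochizukiFrdI2008, Def. 1.1(iii) p.20] -/
theorem map_id_eq : map (𝟙 Φ) = 𝟭 (ElemFrobenioid Φ) := rfl

/-- Strict functoriality in `κ`: `F_{κ' ∘ κ} = F_{κ'} ∘ F_κ`. [cite: MochizukiFrdI2008, Def. 1.1(iii) p.20] -/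
theorem map_comp_eq (κ : Φ ⟶ Φ') (κ' : Φ' ⟶ Φ'') : map (κ ≫ κ') = map κ ⋙ map κ' := rfl

/-- The same as a natural isomorphism (identity components). [cite: MochizukiFrdI2008, Def. 1.1(iii) p.20] -/
def mapId : map (𝟙 Φ) ≅ 𝟭 (ElemFrobenioid Φ) := eqToIso map_id_eq

/-- The same as a natural isomorphism (identity components). [cite: MochizukiFrdI2008, Def. 1.1(iii) p.20] -/
def mapComp (κ : Φ ⟶ Φ') (κ' : Φ' ⟶ Φ'') : map (κ ≫ κ') ≅ map κ ⋙ map κ' := eqToIso (map_comp_eq κ κ')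

/-- For an ISOMORPHISM `θ : Φ ≅ Φ'` of monoids on `D`, `map θ.hom ⋙ map θ.inv = 𝟭`.
[cite: MochizukiFrdI2008, Def. 1.1(iii) p.20] -/
theorem map_hom_comp_map_inv (θ : Φ ≅ Φ') : map θ.hom ⋙ map θ.inv = 𝟭 (ElemFrobenioid Φ) := by
  rw [← map_comp_eq, Iso.hom_inv_id, map_id_eq]

/-- For an isomorphism `θ : Φ ≅ Φ'`, `map θ.inv ⋙ map θ.hom = 𝟭`. [cite: MochizukiFrdI2008, Def. 1.1(iii) p.20] -/
theorem map_inv_comp_map_hom (θ : Φ ≅ Φ') : map θ.inv ⋙ map θ.hom = 𝟭 (ElemFrobenioid Φ') := by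
  rw [← map_comp_eq, Iso.inv_hom_id, map_id_eq]

/-- `θ⁻¹_A (θ_A x) = x` for an isomorphism `θ : Φ ≅ Φ'` of monoids on `D`. [cite: MochizukiFrdI2008, Def. 1.1(iii) p.20] -/
@[simp] theorem iso_inv_app_hom_app_apply (θ : Φ ≅ Φ') (A : Dᵒᵖ) (x : Φ.obj A) :
    (θ.inv.app A).hom ((θ.hom.app A).hom x) = x := by
  have h := congrArg (fun g => (CommMonCat.Hom.hom g) x) (θ.hom_inv_id_app A)
  simpa only [CommMonCat.hom_comp, MonoidHom.coe_comp, Function.comp_apply, CommMonCat.hom_id,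
    MonoidHom.id_apply] using h

/-- `θ_A (θ⁻¹_A y) = y` for an isomorphism `θ : Φ ≅ Φ'` of monoids on `D`. [cite: MochizukiFrdI2008, Def. 1.1(iii) p.20] -/
@[simp] theorem iso_hom_app_inv_app_apply (θ : Φ ≅ Φ') (A : Dᵒᵖ) (y : Φ'.obj A) :
    (θ.hom.app A).hom ((θ.inv.app A).hom y) = y := by
  have h := congrArg (fun g => (CommMonCat.Hom.hom g) y) (θ.inv_hom_id_app A)
  simpa only [CommMonCat.hom_comp, MonoidHom.coe_comp, Function.comp_apply, CommMonCat.hom_id,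
    MonoidHom.id_apply] using h

/-- `map θ.inv (map θ.hom φ) = φ` on the nose (objects are fixed, so this is an equation of morphisms).
[cite: MochizukiFrdI2008, Def. 1.1(iii) p.20] -/
@[simp] theorem map_inv_map_map_hom_map (θ : Φ ≅ Φ') {A B : ElemFrobenioid Φ} (φ : A ⟶ B) :
    (map θ.inv).map ((map θ.hom).map φ) = φ :=
  Hom.ext rfl (iso_inv_app_hom_app_apply θ _ _) rfl

/-- `map θ.hom (map θ.inv ψ) = ψ` on the nose. [cite: MochizukiFrdI2008, Def. 1.1(iii) p.20] -/
@[simp] theorem map_hom_map_map_inv_map (θ : Φ ≅ Φ') {A B : ElemFrobenioid Φ'} (ψ : A ⟶ B) :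
    (map θ.hom).map ((map θ.inv).map ψ) = ψ :=
  Hom.ext rfl (iso_hom_app_inv_app_apply θ _ _) rfl

/-- **An isomorphism `θ : Φ ≅ Φ'` of monoids on `D` induces an equivalence (indeed an isomorphism) of
categories `F_Φ ≌ F_{Φ'}`** (functoriality of `Φ ↦ F_Φ`, FrdI Def. 1.1 (iii)); unit and counit have
identity components. [cite: MochizukiFrdI2008, Def. 1.1(iii) p.20] -/
def mapEquivOfIso (θ : Φ ≅ Φ') : ElemFrobenioid Φ ≌ ElemFrobenioid Φ' where
  functor := map θ.hom
  inverse := map θ.inv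
  unitIso := NatIso.ofComponents (fun A => Iso.refl A) fun {A B} φ => by
    simp only [Functor.id_obj, map_obj, Functor.id_map, Iso.refl_hom, Functor.comp_map]
    erw [map_inv_map_map_hom_map, Category.comp_id, Category.id_comp]
  counitIso := NatIso.ofComponents (fun A => Iso.refl A) fun {A B} ψ => by
    simp only [map_obj, Functor.id_obj, Functor.comp_map, Iso.refl_hom, Functor.id_map]
    erw [map_hom_map_map_inv_map, Category.comp_id, Category.id_comp]
  functor_unitIso_comp A := by
    simp only [Functor.id_obj, map_obj, NatIso.ofComponents_hom_app, Iso.refl_hom, Category.comp_id]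
    exact (map θ.hom).map_id A

/-- In particular `map θ.hom` is an equivalence. [cite: MochizukiFrdI2008, Def. 1.1(iii) p.20] -/
theorem isEquivalence_map_of_iso (θ : Φ ≅ Φ') : (map θ.hom).IsEquivalence :=
  (mapEquivOfIso θ).isEquivalence_functor

end ElemFrobenioid

/-! ### The isomorphism `Φ ⥲ d · Φ` for an injective endomorphism (our formulation, for use with
Definition 2.4 (iii)'s subfunctor `d · Φ(−) ⊆ Φ(−)` and Prop. 2.5 (iii) (b)'s `F_{d·Φ} = (F_Φ)(d) ⊆ F_Φ`) -/

/-- **The natural isomorphism `δ : Φ ⥲ d · Φ`** of monoids on `D`, for an endomorphism `δ : Φ → Φ` that is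
injective on every `Φ(A)` (the binder `hδ`): objectwise the `imageEquiv` of `CdTransport.lean`, natural by
the naturality of `δ`.  OUR formulation (print writes no such isomorphism): FrdI Def. 2.4 (iii), p. 48
ll. 34–36, says only that "multiplication by `d` on `Φ(−)` determines a “Frobenius functor” [associated to
`d` — cf. Proposition 2.1, (ii)] `F_Φ → F_Φ`", and Prop. 2.5 (iii) (b), p. 49 l. 9, uses the identification
"`F_{d·Φ} = (F_Φ)(d) ⊆ F_Φ`"; when `δ` = multiplication by `d` is injective, this isomorphism onto the
subfunctor `d · Φ ⊆ Φ` is what makes that identification available in the tree.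
[cite: MochizukiFrdI2008, Def. 2.4(iii) p.48] -/
def imageMonoidIso (δ : Φ ⟶ Φ) (hδ : ∀ A : Dᵒᵖ, Function.Injective (δ.app A).hom) : Φ ≅ imageMonoid δ :=
  NatIso.ofComponents (fun A => (imageEquiv δ hδ A).toCommMonCatIso) fun {A B} f => by
    apply CommMonCat.hom_ext
    ext x
    apply Subtype.ext
    change (δ.app B).hom ((Φ.map f).hom x) = (Φ.map f).hom ((δ.app A).hom x)
    have h := congrArg (fun g => (CommMonCat.Hom.hom g) x) (δ.naturality f)
    simpa only [CommMonCat.hom_comp, MonoidHom.coe_comp, Function.comp_apply] using h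

/-- The components of `imageMonoidIso` are the `imageEquiv`s: underlying element `δ(x)`.
[cite: MochizukiFrdI2008, Def. 2.4(iii) p.48] -/
@[simp] theorem coe_imageMonoidIso_hom_app (δ : Φ ⟶ Φ) (hδ : ∀ A : Dᵒᵖ, Function.Injective (δ.app A).hom)
    (A : Dᵒᵖ) (x : Φ.obj A) : (((imageMonoidIso δ hδ).hom.app A).hom x).1 = (δ.app A).hom x := rfl

/-- `imageMonoidIso` followed by the inclusion `d · Φ ⊆ Φ` is `δ`. [cite: MochizukiFrdI2008, Def. 2.4(iii) p.48] -/
theorem imageMonoidIso_hom_comp_ι (δ : Φ ⟶ Φ) (hδ : ∀ A : Dᵒᵖ, Function.Injective (δ.app A).hom) :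
    (imageMonoidIso δ hδ).hom ≫ imageMonoidι δ = δ := by
  ext A : 2
  apply CommMonCat.hom_ext
  ext x
  rfl

end Literature.AlgebraicGeometry.Frobenioids

end
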